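import Literature.AlgebraicGeometry.Resolution.RegularBlowup
import Literature.AlgebraicGeometry.Resolution.Blowups
import Literature.AlgebraicGeometry.Resolution.BlowupsProperProofs
import Literature.AlgebraicGeometry.Resolution.PointBlowupHilbertSamuelStrata
import Literature.AlgebraicGeometry.Resolution.ExceptionalFibreConnected
import Literature.AlgebraicGeometry.Resolution.SubschemeRegularStalks
import HarnessLib

/-!
# The blow-up of the closed point of a two-dimensional regular local ring

Topic: `Literature/AlgebraicGeometry/Resolution`. Brick (Y) of the sub-cell «(1.2) 2-reg» of the D-0154 (2)
RES inputs cell (planner skeleton `F79_2reg_BRICKS_SKELETON.lean`, `stub_blowup_closedPoint`): for `T` a regular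
local ring of dimension two and `bl : Y₁ → Spec T` the blowing up (universal property, `IsBlowup`) along the ideal
sheaf `I` of the closed point (`I(⊤) = 𝔪_T`), the scheme `Y₁` is integral and Noetherian, `bl` is proper, `Y₁` is
regular, and every local ring of `Y₁` has dimension `≤ 2` — Lipman 1969, proof of Prop. (1.2), statement A)
("if `X` is any regular surface and `j : Z → X` is a quadratic transformation …": `Z` is again a regular surface).
Everything is assembled from tree theorems: `IsBlowup.isIntegral`, `IsBlowup.isProper`,
`IsBlowup.isRegular_of_isRegular_subscheme` (the centre `V(𝔪) = Spec κ` is regular), `IsBlowup.ringKrullDim_stalk_le`.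
No definitions, no named facts; nothing about (1.2) itself is proved here.

## Sources

* J. Lipman, Publ. Math. IHÉS 36 (1969), §0 (4) and proof of Prop. (1.2), statement A), p. 200. [Lipman1969]
* U. Görtz, T. Wedhorn, *Algebraic Geometry I*, 2nd ed. (2020), Prop. 13.91, Prop. 13.96. [GortzWedhorn2020]
-/

noncomputable section

open CategoryTheory AlgebraicGeometry TopologicalSpace IsLocalRing
open Scheme.IdealSheafData

namespace Literature.AlgebraicGeometry.Resolution

universe u

/-- On `Spec T`, `T` local: the stalk at a point `x` of the ideal sheaf with top ideal `𝔪_T` is contained in the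
maximal ideal only at the closed point, where it IS the maximal ideal. [folklore] -/
private theorem stalkIdeal_eq_maximalIdeal_of_ideal_top_eq_map_maximalIdeal {T : Type u} [CommRing T] [IsLocalRing T]
    (I : (Spec (.of T)).IdealSheafData)
    (hI : I.ideal ⟨⊤, isAffineOpen_top _⟩ = Ideal.map (Scheme.ΓSpecIso (.of T)).inv.hom (maximalIdeal T))
    {x : Spec (.of T)} (hx : x ∈ I.support) :
    stalkIdeal I x = maximalIdeal ((Spec (.of T)).presheaf.stalk x) := by
  letI : Algebra T ((Spec (.of T)).presheaf.stalk x) := StructureSheaf.stalkAlgebra T x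
  haveI : IsLocalization.AtPrime ((Spec (.of T)).presheaf.stalk x) x.asIdeal :=
    StructureSheaf.IsLocalization.to_stalk T x
  -- the stalk ideal is the extension of `𝔪_T` along `T → T_x`
  have hgerm : ((Spec (.of T)).presheaf.germ ⊤ x trivial).hom.comp (Scheme.ΓSpecIso (.of T)).inv.hom =
      algebraMap T ((Spec (.of T)).presheaf.stalk x) := by
    rw [← CommRingCat.hom_comp, Scheme.ΓSpecIso_inv]
    exact congrArg CommRingCat.Hom.hom (StructureSheaf.algebraMap_germ (R := T) ⊤ x trivial)
  have hst : stalkIdeal I x = (maximalIdeal T).map (algebraMap T ((Spec (.of T)).presheaf.stalk x)) := by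
    rw [stalkIdeal_eq_map_germ I ⟨⊤, isAffineOpen_top _⟩ (trivial : x ∈ (⊤ : (Spec (.of T)).Opens)), hI,
      Ideal.map_map, hgerm]
  -- `x` is the closed point: `𝔪_T ⊆ x`
  have hle : stalkIdeal I x ≤ maximalIdeal _ := (mem_support_iff_stalkIdeal_le _ _).mp hx
  have hmx : maximalIdeal T ≤ x.asIdeal := by
    intro t ht
    have h1 : algebraMap T _ t ∈ maximalIdeal ((Spec (.of T)).presheaf.stalk x) :=
      hle (hst ▸ Ideal.mem_map_of_mem _ ht)
    exact (IsLocalization.AtPrime.to_map_mem_maximal_iff ((Spec (.of T)).presheaf.stalk x) x.asIdeal t).mp h1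
  have hxm : x.asIdeal = maximalIdeal T :=
    ((maximalIdeal.isMaximal T).eq_of_le x.2.ne_top hmx).symm
  rw [hst, ← hxm]
  exact IsLocalization.AtPrime.map_eq_maximalIdeal x.asIdeal _

/-- **The blow-up of the closed point of a two-dimensional regular local ring is a regular surface**: for
`T` regular local of dimension `2`, `I` the ideal sheaf on `Spec T` with `I(⊤) = 𝔪_T` and `bl : Y₁ → Spec T` a
blowing up along `I`: `Y₁` is integral and Noetherian, `bl` is proper, `Y₁` is regular, and `dim 𝒪_{Y₁,y} ≤ 2`
for every `y`. [cite: Lipman1969, Proposition (1.2), proof of statement A) (p. 200)]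
[cite: GortzWedhorn2020, Prop. 13.91 and Prop. 13.96] -/
theorem isRegular_of_isBlowup_closedPoint_of_isRegularLocalRing {T : Type u} [CommRing T] [IsRegularLocalRing T]
    (hT : ringKrullDim T = 2) (I : (Spec (.of T)).IdealSheafData)
    (hI : I.ideal ⟨⊤, isAffineOpen_top _⟩ =
      Ideal.map (Scheme.ΓSpecIso (.of T)).inv.hom (maximalIdeal T))
    {Y₁ : Scheme.{u}} (bl : Y₁ ⟶ Spec (.of T)) (hbl : IsBlowup bl I) :
    IsIntegral Y₁ ∧ IsNoetherian Y₁ ∧ IsProper bl ∧ Scheme.IsRegular Y₁ ∧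
      ∀ y : Y₁, ringKrullDim (Y₁.presheaf.stalk y) ≤ 2 := by
  haveI := isDomain_of_isRegularLocalRing T
  haveI := isRegularRing_of_isRegularLocalRing T
  -- `I ≠ 0` (`𝔪_T ≠ 0` as `dim T = 2`)
  have hI0 : I ≠ ⊥ := by
    intro h
    have h1 : Ideal.map (Scheme.ΓSpecIso (.of T)).inv.hom (maximalIdeal T) = ⊥ := by
      rw [← hI, h]; rfl
    rw [Ideal.map_eq_bot_iff_of_injective
      (ConcreteCategory.bijective_of_isIso (Scheme.ΓSpecIso (.of T)).inv).1] at h1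
    have hf : IsField T := (IsLocalRing.isField_iff_maximalIdeal_eq).mpr h1
    have h0 := ringKrullDim_eq_zero_of_isField hf
    rw [hT] at h0
    exact absurd h0 (by decide)
  haveI hprop : IsProper bl := hbl.isProper
  refine ⟨hbl.isIntegral hI0, ?_, hprop, ?_, fun y => ?_⟩
  · haveI : IsLocallyNoetherian Y₁ := LocallyOfFiniteType.isLocallyNoetherian bl
    haveI : CompactSpace Y₁ := QuasiCompact.compactSpace_of_compactSpace bl
    exact {}
  · refine hbl.isRegular_of_isRegular_subscheme (Scheme.isRegular_Spec (.of T)) ?_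
    refine Scheme.isRegular_subscheme_of_forall I fun x hx => ?_
    rw [stalkIdeal_eq_maximalIdeal_of_ideal_top_eq_map_maximalIdeal I hI hx]
    letI := Ideal.Quotient.field (maximalIdeal ((Spec (.of T)).presheaf.stalk x))
    infer_instance
  · refine (hbl.ringKrullDim_stalk_le y).trans ?_
    letI : Algebra T ((Spec (.of T)).presheaf.stalk (bl y)) := StructureSheaf.stalkAlgebra T _
    haveI : IsLocalization.AtPrime ((Spec (.of T)).presheaf.stalk (bl y)) (bl y).asIdeal :=
      StructureSheaf.IsLocalization.to_stalk T _
    rw [← hT, IsLocalization.AtPrime.ringKrullDim_eq_height (bl y).asIdeal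
      ((Spec (.of T)).presheaf.stalk (bl y))]
    exact Ideal.height_le_ringKrullDim_of_ne_top (bl y).2.ne_top
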